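import Literature.NumberTheory.Automorphic.HarishChandraDiracGL
import Literature.NumberTheory.Automorphic.CuspFormArchConvolutionAutomorphy
import Literature.NumberTheory.Automorphic.LangAutomorphicFormsAdmissibleProofs
import Literature.NumberTheory.Automorphic.AutomorphicRepAdmissibilityProofs
import HarnessLib

/-!
# Harish-Chandra's admissibility consequence for automorphic forms on `GL_n`
# (`AutomorphicRepsGL.exists_finiteDimensional_convolution_mem`) from Harish-Chandra's FINITENESS
# theorem (Borel–Jacquet 4.3 (i)): the global route

Topic `NumberTheory/Automorphic`; sibling proof file of `HarishChandraDiracGL`, whose named fact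
`AutomorphicRepsGL.exists_finiteDimensional_convolution_mem hcpt` (for an automorphic form `φ` on
`GL_n(𝔸_K)` and a Haar measure `ν` on `GL_n(K_∞)` there is a finite-dimensional space `V` of functions
containing `π(α) φ = (g ↦ ∫ φ(g x) α(x) dν)` for every admissible weight `α` — continuous, compactly
supported, smooth, supported in `GL_n(K_∞)°`, `Ad K_∞`-invariant) is the deep layer of
Harish-Chandra's convolution identity `φ = φ ∗ α` (`HarishChandraConvolutionGL`, Step 2 of
Borel–Jacquet 4.6 for `GL_n`). In print it is Harish-Chandra's ADMISSIBILITY theorem (Borel 1972,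
Thm. 3.17, with the first half of the proof of Thm. 3.18): a local statement about the closure of
`U(𝔤₁) φ` under the semisimple part of the archimedean group, whose proof needs (i) the analyticity
of `K`-finite `Z(𝔤)`-finite functions (Borel 1972, 3.14–3.15 — now the tree's THEOREM
`analyticAt_apply_expMem_smul_of_isKFinite_of_isZFinite`, `KFiniteZFiniteAnalytic`), (ii)
Harish-Chandra's algebraic finiteness theorem for `U(𝔤)`-modules (Harish-Chandra 1953, Thm. 1 =
Borel 1972, 1.4–1.5; absent from the tree) and (iii) the continuous `K`-isotypic projections.

This file PROVES the fact along the OTHER classical route, from Harish-Chandra's FINITENESS theorem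
for automorphic forms (Borel–Jacquet 1979, 4.3 (i); Harish-Chandra, LNM 62, Thm. 1) — the named
fact `harishChandra_finiteness hcpt` of `LangAutomorphicForms` (ideal form), a global statement
resting on reduction theory, already the hypothesis of the tree's admissibility theorems
(`LangAutomorphicFormsAdmissibleProofs`):

* `IsAutomorphicForm.exists_finiteDimensional_archConv_mem_of_harishChandra_finiteness` — for an
  automorphic form `φ` of level `{1} × U₀` the convolutions `φ ∗ β̌ = (g ↦ ∫ φ(g x) β(x) dν₀)`
  (`archConv`, `ν₀ = levelArchMeasure U₀`) by the real admissible weights `β` all lie in ONE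
  finite-dimensional space, namely Harish-Chandra's space `𝒜(U, J, M)` of automorphic forms of level
  `U = {1} × U₀`, killed by the annihilator ideal `J ≤ Z(𝔤)` of `φ` (of finite codimension,
  `exists_ideal_finiteCodim_forall_applyFree_eq_zero`), and with `K_∞`-slices in the space `M` of
  matrix coefficients of the `K_∞`-span `E` of `φ` (`coeffSpace`): `φ ∗ β̌` is an automorphic form
  (`IsAutomorphicForm.archConv`, Borel–Jacquet 4.2–4.3), of level `U` (`G_∞` commutes with
  `G(𝔸_f)`), killed by `J` (central words commute with `∗ β̌`,
  `applyFree_archConv_of_isCentralWord`, Borel 1997, 2.5), and `(φ ∗ β̌)(g k) = ((r(k) φ) ∗ β̌)(g)`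
  (`archConv_apply_mul_ofInfiniteAdelic`, Borel 1972, 3.5) is the matrix coefficient
  `k ↦ ℓ_g (r(k) φ)` of `E`, `ℓ_g = (e ↦ (e ∗ β̌)(g))`.
* `AutomorphicRepsGL.exists_finiteDimensional_convolution_mem_of_harishChandra_finiteness` —
  **`harishChandra_finiteness hcpt → exists_finiteDimensional_convolution_mem hcpt`**: a complex
  admissible weight splits into its real and imaginary parts, and a Haar measure `ν` is a multiple
  of the level measure (uniqueness of Haar measure), exactly as in the cuspidal discharge
  `IsCuspFormGL.exists_finiteDimensional_convolution_mem_of_center'` of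
  `AutomorphicRepsGLCuspidalConvolutionHolds` (where finite-dimensionality comes from `L²` instead).
* Consequences (one-liners through the proved reductions of `HarishChandraDiracGL`): Harish-Chandra's
  convolution identity `exists_convolution_eq_self hcpt`, the `L²` side of Step 2 of Borel–Jacquet
  4.6 `exists_toLp_mem_invQuot_eq_lieDeriv hcpt μ` and `formsOfL2_isStableSubmodule hcpt μ`, all on
  the trust base `{harishChandra_finiteness}`.

Everything here is proved; no definition, no named fact. The Borel route is not made obsolete by
this file: it is the one that does not use reduction theory, and its analytic input is proved in
`KFiniteZFiniteAnalytic`; what it still lacks is (ii) above.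

## References

* A. Borel, H. Jacquet, *Automorphic forms and automorphic representations*, Proc. Sympos. Pure
  Math. 33 (Corvallis 1977), Part 1 (1979), 4.2–4.3, 4.5, 4.6 [BorelJacquet1979].
* Harish-Chandra, *Automorphic forms on semisimple Lie groups*, LNM 62 (1968), Thm. 1.
* A. Borel, *Représentations de groupes localement compacts*, LNM 276 (1972), 3.5, Thm. 3.17 and
  proof of Thm. 3.18 (p. 26) [Borel1972] (held).
* A. Borel, *Automorphic forms on `SL₂(ℝ)`* (1997), 2.5, Thm. 2.14 [Borel1997] (held).
-/

noncomputable section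

-- Mathlib idiom (Mathlib/Algebra/Lie/OfAssociative.lean); needed to mention Lie subalgebras of matrix algebras
attribute [local instance 100] LieRing.ofAssociativeRing

open scoped MatrixGroups Matrix ContDiff Topology Classical NNReal
open Filter Set NumberField NumberField.mixedEmbedding IsDedekindDomain
open _root_.MeasureTheory _root_.MeasureTheory.Measure

namespace Literature.NumberTheory.Automorphic

-- `M_n(K ⊗ ℝ)` is finite-dimensional over `ℝ` (the tree's instance, as in `HarishChandraDiracGL`)
attribute [local instance] finiteDimensional_matrix_mixedSpace

variable {n : ℕ} {K : Type} [Field K] [NumberField K]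

/-! ### 1. The convolutions `φ ∗ β̌` lie in Harish-Chandra's space `𝒜(U, J, M)` -/

section LevelMeasure

-- the tree's measurable structures on `GL_n(K_∞)` and `GL_n(𝔸_K)` (as in `CuspFormArchConvolutionAutomorphy`)
attribute [local instance] glInfBorel borelSpace_glInf locallyCompactSpace_glInf
  secondCountableTopology_glInf adelicBorel borelSpace_adelic locallyCompactSpace_adelic
  secondCountableTopology_gl_adelic

variable {hcpt : isCompact_glFiniteIntegralLevel n K}
  {U₀ : Subgroup (GL (Fin n) (FiniteAdeleRing (𝓞 K) K))}

-- the scoped operator norm on `𝔤𝔩_n(K_∞)`, through which `IsArchSmooth` is defined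
open scoped Matrix.Norms.Operator

set_option maxHeartbeats 800000 in
/-- **The convolutions of an automorphic form by the real admissible weights span a
finite-dimensional space, granted Harish-Chandra's finiteness theorem** (Borel–Jacquet 1979, 4.3 (i),
the named fact `harishChandra_finiteness hcpt`). For an automorphic form `φ` on `GL_n(𝔸_K)` of level
`{1} × U₀` (`U₀` compact open) there is a finite-dimensional complex space `V` of functions on
`GL_n(𝔸_K)` containing `φ ∗ β̌ = archConv ν₀ β̌ φ = (g ↦ ∫ φ(g x) β(x) dν₀)`, `ν₀ = levelArchMeasure U₀`,
for every real admissible weight `β` (continuous, compactly supported, smooth through the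
complexification, `Ad K_∞`-invariant): `V = 𝒜(U, J, M)`, the span of the automorphic forms of level
`U = {1} × U₀` killed by the annihilator ideal `J` of `φ` in `Z(𝔤)` (finite codimension,
`exists_ideal_finiteCodim_forall_applyFree_eq_zero`) whose `K_∞`-slices `k ↦ ψ(g k)` lie in the space
`M` of matrix coefficients of the `K_∞`-span of `φ` (`coeffSpace`); `φ ∗ β̌` qualifies by
`IsAutomorphicForm.archConv`, `applyFree_archConv_of_isCentralWord` (central words commute with
`∗ β̌`) and `archConv_apply_mul_ofInfiniteAdelic` (`(φ ∗ β̌)(g k) = ((r(k) φ) ∗ β̌)(g)`).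
[cite: BorelJacquet1979, 4.3 (i)] -/
theorem IsAutomorphicForm.exists_finiteDimensional_archConv_mem_of_harishChandra_finiteness
    (hHC : harishChandra_finiteness hcpt)
    (hU₀o : IsOpen (U₀ : Set (GL (Fin n) (FiniteAdeleRing (𝓞 K) K))))
    (hU₀c : IsCompact (U₀ : Set (GL (Fin n) (FiniteAdeleRing (𝓞 K) K))))
    {φ : (AdelicGroupData.gl n K).Adelic → ℂ} (hφ : IsAutomorphicForm (AutomorphyDatum.gl n K hcpt) φ)
    (hφU : IsRightInvariantUnder (U₀.map (GLn.ofFiniteAdelic n K)) φ) :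
    ∃ V : Submodule ℂ ((AdelicGroupData.gl n K).Adelic → ℂ), FiniteDimensional ℂ V ∧
      ∀ β : GL (Fin n) (mixedSpace K) → ℝ, Continuous β → HasCompactSupport β →
        IsArchSmooth (archGroupGL n K).carrier.subtype (fun y => ((β y : ℝ) : ℂ)) →
        (∀ k ∈ Kinf n K, ∀ x, β (k * x * k⁻¹) = β x) →
          Literature.NumberTheory.Automorphic.archConv (levelArchMeasure n K U₀)
            (fun y => ((β y⁻¹ : ℝ) : ℂ)) φ ∈ V := by
  -- the level measure and the level
  set ν : Measure (GL (Fin n) (mixedSpace K)) := levelArchMeasure n K U₀ with hν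
  haveI := isMulLeftInvariant_levelArchMeasure (n := n) (K := K) (U₀ := U₀)
  haveI := isMulRightInvariant_levelArchMeasure (n := n) (K := K) (U₀ := U₀)
  haveI := isFiniteMeasureOnCompacts_levelArchMeasure (n := n) (K := K) (U₀ := U₀) hU₀c
  have hU : U₀.map (GLn.ofFiniteAdelic n K) ∈ (AutomorphyDatum.gl n K hcpt).finiteLevels :=
    map_ofFiniteAdelic_mem_finiteLevels hU₀o hU₀c
  have hφc : Continuous φ := hφ.continuous_gl
  /- (i) the `K_∞`-span `E` of `φ`: finite-dimensional, `K_∞`-stable, made of continuous functions -/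
  set E : Submodule ℂ ((AdelicGroupData.gl n K).Adelic → ℂ) :=
    kTranslateSpan (AutomorphyDatum.gl n K hcpt).ofArch φ with hE_def
  haveI hEfin : FiniteDimensional ℂ E := hφ.kFinite
  have hφE : φ ∈ E := by
    have h := archTranslate_mem_kTranslateSpan (AutomorphyDatum.gl n K hcpt).ofArch 1 φ
    simpa only [map_one, Module.End.one_apply] using h
  have hEk : ∀ (k : (AutomorphyDatum.gl n K hcpt).arch.maximalCompact), ∀ ψ ∈ E,
      rightTranslation (AdelicGroupData.gl n K) ((AutomorphyDatum.gl n K hcpt).ofK k) ψ ∈ E := by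
    intro k ψ hψ
    rw [hE_def] at hψ ⊢
    induction hψ using Submodule.span_induction with
    | mem ψ hψ =>
      obtain ⟨k', rfl⟩ := hψ
      refine Submodule.subset_span ⟨k * k', ?_⟩
      funext h
      simp only [rightTranslation_apply, archTranslate_apply, AutomorphyDatum.ofK_apply]
      rw [map_mul, map_mul, ← mul_assoc]
    | zero => rw [map_zero]; exact Submodule.zero_mem _
    | add ψ ψ' _ _ h₁ h₂ => rw [map_add]; exact Submodule.add_mem _ h₁ h₂
    | smul c ψ _ h₁ => rw [map_smul]; exact Submodule.smul_mem _ c h₁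
  have hEc : ∀ ψ ∈ E, Continuous ψ := by
    intro ψ hψ
    rw [hE_def] at hψ
    induction hψ using Submodule.span_induction with
    | mem ψ hψ =>
      obtain ⟨k', rfl⟩ := hψ
      exact hφc.comp (continuous_id.mul continuous_const)
    | zero => exact continuous_const
    | add ψ ψ' _ _ h₁ h₂ => exact h₁.add h₂
    | smul c ψ _ h₁ => exact h₁.const_smul c
  -- the representation of `K_∞` on `E` by right translation, and its matrix coefficients `M`
  let σ : (AutomorphyDatum.gl n K hcpt).arch.maximalCompact → E →ₗ[ℂ] E := fun k =>
    (rightTranslation (AdelicGroupData.gl n K) ((AutomorphyDatum.gl n K hcpt).ofK k)).restrict (hEk k)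
  have hσ_coe : ∀ (k : (AutomorphyDatum.gl n K hcpt).arch.maximalCompact) (e : E),
      ((σ k e : E) : (AdelicGroupData.gl n K).Adelic → ℂ) =
        rightTranslation (AdelicGroupData.gl n K) ((AutomorphyDatum.gl n K hcpt).ofK k) e := fun _ _ => rfl
  have hσ : ∀ k k', σ (k * k') = σ k ∘ₗ σ k' := by
    intro k k'
    refine LinearMap.ext fun e => Subtype.ext ?_
    rw [LinearMap.comp_apply, hσ_coe, hσ_coe, hσ_coe, map_mul, map_mul, Module.End.mul_apply]
  set M : Submodule ℂ ((AutomorphyDatum.gl n K hcpt).arch.maximalCompact → ℂ) := coeffSpace σ with hM_def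
  haveI hMfin : FiniteDimensional ℂ M := finiteDimensional_coeffSpace σ
  have hM : ∀ k₀ : (AutomorphyDatum.gl n K hcpt).arch.maximalCompact, ∀ f ∈ M, (fun k => f (k * k₀)) ∈ M :=
    fun k₀ f hf => comp_mul_right_mem_coeffSpace hσ k₀ hf
  /- (ii) the annihilator ideal `J` of `φ` in `Z(𝔤)`, of finite codimension -/
  haveI : FiniteDimensional ℂ (ℂ ∙ φ) := inferInstance
  have hsm : ∀ ψ ∈ (ℂ ∙ φ), IsArchSmooth (AutomorphyDatum.gl n K hcpt).ofArch ψ := by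
    intro ψ hψ
    obtain ⟨c, rfl⟩ := Submodule.mem_span_singleton.1 hψ
    exact (Literature.NumberTheory.Automorphic.archSmooth (AutomorphyDatum.gl n K hcpt).ofArch).smul_mem c hφ.archSmooth
  have hZ : ∀ ψ ∈ (ℂ ∙ φ), IsZFinite (AutomorphyDatum.gl n K hcpt).ofArch ψ := by
    intro ψ hψ
    obtain ⟨c, rfl⟩ := Submodule.mem_span_singleton.1 hψ
    haveI : FiniteDimensional ℂ (zOrbitSpan (AutomorphyDatum.gl n K hcpt).ofArch φ) := hφ.zFinite
    change FiniteDimensional ℂ (zOrbitSpan (AutomorphyDatum.gl n K hcpt).ofArch (c • φ))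
    refine Submodule.finiteDimensional_of_le (S₂ := zOrbitSpan (AutomorphyDatum.gl n K hcpt).ofArch φ) ?_
    refine Submodule.span_le.2 ?_
    rintro _ ⟨p, hp, rfl⟩
    rw [applyFree_smul_right]
    exact Submodule.smul_mem _ c (Submodule.subset_span ⟨p, hp, rfl⟩)
  obtain ⟨J, hJfin, hJ⟩ := exists_ideal_finiteCodim_forall_applyFree_eq_zero
    (AutomorphyDatum.gl n K hcpt).ofArch (ℂ ∙ φ) hsm hZ
  /- (iii) Harish-Chandra's space `V = 𝒜(U, J, M)`, finite-dimensional by `hHC` -/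
  refine ⟨_, harishChandra_finiteness.apply_gl hHC hU J hJfin M hMfin hM, fun β hβc hβs hβsm hβK => ?_⟩
  refine Submodule.subset_span ⟨?_, ?_, ?_, ?_⟩
  · -- an automorphic form
    exact IsAutomorphicForm.archConv hU₀o hU₀c hφ hφU hβc hβs hβsm hβK
  · -- of level `{1} × U₀`
    have hlev : ∀ u ∈ U₀.map (GLn.ofFiniteAdelic n K), ∀ g : (AdelicGroupData.gl n K).Adelic,
        Literature.NumberTheory.Automorphic.archConv ν (fun y => ((β y⁻¹ : ℝ) : ℂ)) φ (g * u) =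
          Literature.NumberTheory.Automorphic.archConv ν (fun y => ((β y⁻¹ : ℝ) : ℂ)) φ g := by
      rintro _ ⟨u, hu, rfl⟩ g
      simp only [archConv_apply]
      congr 1 with y
      have hcomm : GLn.ofFiniteAdelic n K u * GLn.ofInfiniteAdelic n K y =
          GLn.ofInfiniteAdelic n K y * GLn.ofFiniteAdelic n K u :=
        (GLn.commute_ofInfinite_ofFinite (n := n) (K := K) y u).eq.symm
      rw [mul_assoc, hcomm, ← mul_assoc, hφU _ (Subgroup.mem_map_of_mem _ hu)]
    exact hlev
  · -- killed by `J`: central words commute with `∗ β̌`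
    intro p hp hpJ
    rw [applyFree_archConv_of_isCentralWord hU₀o hU₀c hβc hβs hφ.archSmooth hφU hp,
      hJ p hp hpJ φ (Submodule.mem_span_singleton_self φ)]
    funext g
    simp [archConv_apply]
  · -- the `K_∞`-slices are matrix coefficients of `E`
    intro g
    have hαK := adInvariant_ofReal_comp_inv hβK
    have hαc := continuous_ofReal_comp_inv hβc
    have hαs := hasCompactSupport_ofReal_comp_inv hβs
    -- the linear functional `ℓ_g e = (e ∗ β̌)(g)` on `E`
    have hint : ∀ e ∈ E, Integrable (fun y : GL (Fin n) (mixedSpace K) =>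
        e (g * GLn.ofInfiniteAdelic n K y) * ((β y⁻¹⁻¹ : ℝ) : ℂ)) ν := by
      intro e he
      have h1 : Continuous fun y : GL (Fin n) (mixedSpace K) => e (g * GLn.ofInfiniteAdelic n K y) :=
        (hEc e he).comp (continuous_const.mul (GLn.continuous_ofInfiniteAdelic n K))
      have hfun : (fun y : GL (Fin n) (mixedSpace K) => ((β y⁻¹⁻¹ : ℝ) : ℂ)) =
          fun y => ((β y : ℝ) : ℂ) := by
        funext y; rw [inv_inv]
      have h2 : Continuous fun y : GL (Fin n) (mixedSpace K) => ((β y⁻¹⁻¹ : ℝ) : ℂ) := by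
        rw [hfun]; exact Complex.continuous_ofReal.comp hβc
      have h3 : HasCompactSupport fun y : GL (Fin n) (mixedSpace K) => ((β y⁻¹⁻¹ : ℝ) : ℂ) := by
        rw [hfun]; exact hβs.comp_left Complex.ofReal_zero
      exact (h1.mul h2).integrable_of_hasCompactSupport h3.mul_left
    let ℓ : E →ₗ[ℂ] ℂ :=
      { toFun := fun e => Literature.NumberTheory.Automorphic.archConv ν (fun y => ((β y⁻¹ : ℝ) : ℂ)) e g
        map_add' := fun e e' => by
          simp only [archConv_apply, Submodule.coe_add, Pi.add_apply, add_mul]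
          exact integral_add (hint e e.2) (hint e' e'.2)
        map_smul' := fun c e => by
          simp only [archConv_apply, Submodule.coe_smul, Pi.smul_apply, smul_eq_mul, RingHom.id_apply,
            mul_assoc]
          exact integral_const_mul c _ }
    have hℓ : ∀ e : E, ℓ e = Literature.NumberTheory.Automorphic.archConv ν (fun y => ((β y⁻¹ : ℝ) : ℂ)) e g :=
      fun _ => rfl
    have key : (fun k : (AutomorphyDatum.gl n K hcpt).arch.maximalCompact =>
        Literature.NumberTheory.Automorphic.archConv ν (fun y => ((β y⁻¹ : ℝ) : ℂ)) φ
          (g * (AutomorphyDatum.gl n K hcpt).ofK k)) = fun k => ℓ (σ k ⟨φ, hφE⟩) := by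
      funext k
      rw [hℓ, hσ_coe, AutomorphyDatum.ofK_apply, AutomorphyDatum.gl_ofArch_apply]
      have h := archConv_apply_mul_ofInfiniteAdelic ν (k : GL (Fin n) (mixedSpace K))
        (α := fun y => ((β y⁻¹ : ℝ) : ℂ)) (hαK _ k.2) φ g
      exact h
    rw [key]
    exact coeff_mem_coeffSpace σ ℓ ⟨φ, hφE⟩

end LevelMeasure

/-! ### 2. The named fact from Harish-Chandra's finiteness theorem -/

section Fact

-- the tree's topological-measure-theoretic instances on `GL_n(K_∞)` (no measurable structure: the
-- fact quantifies over it)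
attribute [local instance] locallyCompactSpace_glInf secondCountableTopology_glInf

variable {hcpt : isCompact_glFiniteIntegralLevel n K}

-- the scoped operator norm on `𝔤𝔩_n(K_∞)`, through which `IsArchSmooth` is defined
open scoped Matrix.Norms.Operator

set_option maxHeartbeats 800000 in
/-- **`harishChandra_finiteness hcpt → exists_finiteDimensional_convolution_mem hcpt`**: Harish-Chandra's
finiteness theorem for automorphic forms on `GL_n` (Borel–Jacquet 1979, 4.3 (i)) implies the named
fact of `HarishChandraDiracGL` (Borel 1972, Thm. 3.17 with the first half of the proof of Thm. 3.18,
for automorphic forms on `GL_n(𝔸_K)`): for an automorphic form `φ` and a Haar measure `ν` on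
`GL_n(K_∞)` the functions `g ↦ ∫ φ(g x) α(x) dν`, `α` admissible, lie in one finite-dimensional
space. Proof: `α = Re α + i Im α` with `Re α`, `Im α` real admissible weights, `ν = c • ν₀` for the
level measure `ν₀` of a level `{1} × U₀` of `φ` (uniqueness of Haar measure), and
`IsAutomorphicForm.exists_finiteDimensional_archConv_mem_of_harishChandra_finiteness`.
[cite: BorelJacquet1979, 4.3 (i)] [cite: Borel1972, Thm. 3.17 and proof of Thm. 3.18 (p. 26)] -/
theorem AutomorphicRepsGL.exists_finiteDimensional_convolution_mem_of_harishChandra_finiteness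
    (hHC : harishChandra_finiteness hcpt) :
    AutomorphicRepsGL.exists_finiteDimensional_convolution_mem hcpt := by
  intro mG hBG ν hν φ hφ
  -- the measurable structure is the Borel one (the tree's `glInfBorel`)
  have hmG : mG = borel _ := BorelSpace.measurable_eq
  subst hmG
  letI : MeasurableSpace (GL (Fin n) (mixedSpace K)) := borel _
  haveI : BorelSpace (GL (Fin n) (mixedSpace K)) := ⟨rfl⟩
  -- a level `{1} × U₀` fixing `φ`
  obtain ⟨U, hU, hφU⟩ := hφ.exists_level
  rw [AutomorphyDatum.gl_finiteLevels] at hU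
  obtain ⟨U₀, hU₀o, hU₀c, rfl⟩ := mem_finiteLevelsGL_iff.1 hU
  replace hφU : IsRightInvariantUnder (U₀.map (GLn.ofFiniteAdelic n K)) φ := hφU
  -- the level measure `ν₀` and the finite-dimensional space of the convolutions `φ ∗ β̌`
  set ν₀ : Measure (GL (Fin n) (mixedSpace K)) := levelArchMeasure n K U₀ with hν₀
  haveI : ν₀.IsHaarMeasure := isHaarMeasure_levelArchMeasure hU₀o hU₀c
  obtain ⟨V, hV, hmem⟩ :=
    hφ.exists_finiteDimensional_archConv_mem_of_harishChandra_finiteness hHC hU₀o hU₀c hφU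
  haveI := hV
  refine ⟨V, hV, fun α hα => ?_⟩
  obtain ⟨hαc, hαs, hαsm, -, hαK⟩ := hα
  -- `Re α` and `Im α` are real admissible weights
  have hsm : ∀ L : ℂ →L[ℝ] ℝ, IsArchSmooth (archGroupGL n K).carrier.subtype
      (fun y => ((L (α y) : ℝ) : ℂ)) := by
    intro L u
    have h1 := (Complex.ofRealCLM.comp L).contDiff.comp (hαsm u)
    simpa only [Function.comp_def, ContinuousLinearMap.coe_comp, Complex.ofRealCLM_apply] using h1
  have hsm_re : IsArchSmooth (archGroupGL n K).carrier.subtype (fun y => (((α y).re : ℝ) : ℂ)) := by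
    simpa only [Complex.reCLM_apply] using hsm Complex.reCLM
  have hsm_im : IsArchSmooth (archGroupGL n K).carrier.subtype (fun y => (((α y).im : ℝ) : ℂ)) := by
    simpa only [Complex.imCLM_apply] using hsm Complex.imCLM
  have hre : Literature.NumberTheory.Automorphic.archConv ν₀
      (fun y => (((α y⁻¹).re : ℝ) : ℂ)) φ ∈ V :=
    hmem (fun x => (α x).re) (Complex.continuous_re.comp hαc) (hαs.comp_left Complex.zero_re) hsm_re
      (fun k hk x => by rw [hαK k hk x])
  have him : Literature.NumberTheory.Automorphic.archConv ν₀
      (fun y => (((α y⁻¹).im : ℝ) : ℂ)) φ ∈ V :=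
    hmem (fun x => (α x).im) (Complex.continuous_im.comp hαc) (hαs.comp_left Complex.zero_im) hsm_im
      (fun k hk x => by rw [hαK k hk x])
  -- the integrals against `ν₀` split into real and imaginary parts
  have hslice : ∀ g : (AdelicGroupData.gl n K).Adelic,
      Continuous fun x : GL (Fin n) (mixedSpace K) ↦ φ (g * GLn.ofInfiniteAdelic n K x) := fun g ↦
    hφ.continuous_gl.comp (continuous_const.mul (GLn.continuous_ofInfiniteAdelic n K))
  have hint : ∀ {β : GL (Fin n) (mixedSpace K) → ℝ}, Continuous β → HasCompactSupport β →
      ∀ g : (AdelicGroupData.gl n K).Adelic,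
        Integrable (fun x ↦ φ (g * GLn.ofInfiniteAdelic n K x) * ((β x : ℝ) : ℂ)) ν₀ :=
    fun hβc hβs g ↦
      ((hslice g).mul (Complex.continuous_ofReal.comp hβc)).integrable_of_hasCompactSupport
        (hβs.comp_left Complex.ofReal_zero).mul_left
  have hsplit : ∀ g : (AdelicGroupData.gl n K).Adelic,
      ∫ x, φ (g * GLn.ofInfiniteAdelic n K x) * α x ∂ν₀ =
        Literature.NumberTheory.Automorphic.archConv ν₀ (fun y => (((α y⁻¹).re : ℝ) : ℂ)) φ g +
          Complex.I * Literature.NumberTheory.Automorphic.archConv ν₀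
            (fun y => (((α y⁻¹).im : ℝ) : ℂ)) φ g := by
    intro g
    rw [archConv_comp_inv_apply ν₀ (fun x => (((α x).re : ℝ) : ℂ)) φ g,
      archConv_comp_inv_apply ν₀ (fun x => (((α x).im : ℝ) : ℂ)) φ g, ← integral_const_mul,
      ← integral_add (hint (β := fun x => (α x).re) (Complex.continuous_re.comp hαc)
          (hαs.comp_left Complex.zero_re) g)
        ((hint (β := fun x => (α x).im) (Complex.continuous_im.comp hαc)
          (hαs.comp_left Complex.zero_im) g).const_mul _)]
    congr 1 with x
    conv_lhs => rw [← Complex.re_add_im (α x)]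
    ring
  -- uniqueness of Haar measure: `ν = c • ν₀`
  set c : ℝ≥0 := ν.haarScalarFactor ν₀ with hc
  have hν : ν = c • ν₀ := isMulLeftInvariant_eq_smul ν ν₀
  have hscale : ∀ g : (AdelicGroupData.gl n K).Adelic,
      ∫ x, φ (g * GLn.ofInfiniteAdelic n K x) * α x ∂ν =
        ((c : ℝ) : ℂ) * ∫ x, φ (g * GLn.ofInfiniteAdelic n K x) * α x ∂ν₀ := fun g ↦ by
    calc ∫ x, φ (g * GLn.ofInfiniteAdelic n K x) * α x ∂ν
        = ∫ x, φ (g * GLn.ofInfiniteAdelic n K x) * α x ∂(c • ν₀) := by rw [← hν]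
      _ = c • ∫ x, φ (g * GLn.ofInfiniteAdelic n K x) * α x ∂ν₀ := integral_smul_nnreal_measure _ c
      _ = ((c : ℝ) : ℂ) * ∫ x, φ (g * GLn.ofInfiniteAdelic n K x) * α x ∂ν₀ := by
          rw [NNReal.smul_def, Complex.real_smul]
  -- assembling
  have hF : (fun g : (AdelicGroupData.gl n K).Adelic ↦ ∫ x, φ (g * GLn.ofInfiniteAdelic n K x) * α x ∂ν) =
      ((c : ℝ) : ℂ) • (Literature.NumberTheory.Automorphic.archConv ν₀
          (fun y => (((α y⁻¹).re : ℝ) : ℂ)) φ +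
        Complex.I • Literature.NumberTheory.Automorphic.archConv ν₀
          (fun y => (((α y⁻¹).im : ℝ) : ℂ)) φ) := by
    funext g
    rw [hscale g, hsplit g]
    simp only [Pi.smul_apply, Pi.add_apply, smul_eq_mul]
  change (fun g : (AdelicGroupData.gl n K).Adelic ↦ ∫ x, φ (g * GLn.ofInfiniteAdelic n K x) * α x ∂ν) ∈ V
  rw [hF]
  exact V.smul_mem _ (V.add_mem hre (V.smul_mem _ him))

/-! ### 3. Consequences on the trust base `{harishChandra_finiteness}` -/

/-- **Harish-Chandra's convolution identity for automorphic forms on `GL_n(𝔸_K)` from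
Harish-Chandra's finiteness theorem**: `harishChandra_finiteness hcpt → exists_convolution_eq_self hcpt`
(the named fact of `HarishChandraConvolutionGL`: `φ = φ ∗ α` for some `α ∈ C_c^∞(GL_n(K_∞))`), through
Borel's soft layer `exists_convolution_eq_self_of_finiteDimensional` (proof of Borel 1972, Thm. 3.18:
Dirac sequences of admissible weights and closedness of finite-dimensional subspaces).
Harish-Chandra 1966, Thm. 1; Borel–Jacquet 1979, 4.3. [cite: BorelJacquet1979, 4.3] -/
theorem AutomorphicRepsGL.exists_convolution_eq_self_of_harishChandra_finiteness
    (hHC : harishChandra_finiteness hcpt) : AutomorphicRepsGL.exists_convolution_eq_self hcpt :=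
  AutomorphicRepsGL.exists_convolution_eq_self_of_finiteDimensional
    (AutomorphicRepsGL.exists_finiteDimensional_convolution_mem_of_harishChandra_finiteness hHC)

variable {μ : Measure (AdelicGroupData.gl n K).automorphicQuotient}
  [(AdelicGroupData.gl n K).IsAutomorphicMeasure μ]

/-- **The `L²` side of Step 2 of Borel–Jacquet 4.6 for `GL_n` from Harish-Chandra's finiteness
theorem**: `harishChandra_finiteness hcpt → exists_toLp_mem_invQuot_eq_lieDeriv hcpt μ` (Lie
derivatives of the automorphic forms of a closed invariant `Π ≤ L²(μ)` represent vectors of `Π`),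
through `exists_toLp_mem_invQuot_eq_lieDeriv_of_finiteDimensional`. Borel–Jacquet 1979, 4.6.
[cite: BorelJacquet1979, 4.6] -/
theorem AutomorphicRepsGL.exists_toLp_mem_invQuot_eq_lieDeriv_of_harishChandra_finiteness
    (hHC : harishChandra_finiteness hcpt) :
    AutomorphicRepsGL.exists_toLp_mem_invQuot_eq_lieDeriv hcpt μ :=
  AutomorphicRepsGL.exists_toLp_mem_invQuot_eq_lieDeriv_of_finiteDimensional
    (AutomorphicRepsGL.exists_finiteDimensional_convolution_mem_of_harishChandra_finiteness hHC)

/-- **Step 2 of Borel–Jacquet 4.6 for `GL_n` on the trust base `{harishChandra_finiteness}`**: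
`harishChandra_finiteness hcpt → formsOfL2_isStableSubmodule hcpt μ`, through
`formsOfL2_isStableSubmodule_of_finiteDimensional`. Borel–Jacquet 1979, 4.3 and 4.6.
[cite: BorelJacquet1979, 4.6] -/
theorem AutomorphicRepsGL.formsOfL2_isStableSubmodule_of_harishChandra_finiteness
    (hHC : harishChandra_finiteness hcpt) :
    AutomorphicRepsGL.formsOfL2_isStableSubmodule hcpt μ :=
  AutomorphicRepsGL.formsOfL2_isStableSubmodule_of_finiteDimensional
    (AutomorphicRepsGL.exists_finiteDimensional_convolution_mem_of_harishChandra_finiteness hHC)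

end Fact

end Literature.NumberTheory.Automorphic
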